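import Summits.QuantumFields.YangMills.Theorems.IR.TensionRatioFluxTYTwistHelpers
import HarnessLib

/-!
# Crux `IR` (stmt-QuantumFields-19354), line `tension-ratio` (flux skeleton), stub `TYObservable` — part 3b:
# Tomboulis–Yaffe (A1.8) for Polyakov loops in an OBSERVABLE representation

Pooled prover `ym-ir-line-pool-p3` (gen 3).  Helper module for item `stmt-QuantumFields-19354` (`--supports`; it closes
nothing).  Port of the tree theorem `TomboulisYaffe.polyakovCorrelator_half_normSq_le_twist`
(`Literature/…/TomboulisYaffeTwistBound.lean`) to Polyakov loops taken in a PROBE representation `π` carrying the centre charge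
(`π(z) = ω · 1`, `|ω| = 1`) while the twist and the measure are those of the action's representation `ρ` (any continuous `ρ`, any
central `z`, no scalar condition on `ρ(z)`):

  `|1 - ω|² · |⟨tr π(Πⱼ(0)) · conj tr π(Πⱼ((L/2) e₀))⟩_{ρ,β}|² ≤ 8 M⁴ (1 - Z_ρ(z; (0,j)) / Z_ρ(1; (0,j)))`.

The proof is the tree's verbatim: the stack-moving substitution is a property of the `ρ`-measure (`integral_mul_exp_stack_succ`,
`wilsonExpectation_twistObs`, `wilsonExpectation_twistObs_inv_mul_twistObs`, `twistObs_negReflect`), and the probe enters only through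
`tr π(z g) = ω tr π(g)`.  The measure-side helpers of the tree file are re-proved in part 3a; everything is proved; no new
definitions; nothing here bears on the Yang–Mills mass gap.  [cite: TomboulisYaffe1985, App. I §C eq. (A1.8)]
-/

open MeasureTheory Finset Complex
open scoped ComplexOrder ComplexConjugate

noncomputable section

namespace Summit.QuantumFields.YangMills.Cruxes.IR.TensionRatio.FluxTY

open Literature.MathematicalPhysics.QuantumFieldTheory Literature.MathematicalPhysics.QuantumFieldTheory.TomboulisYaffe
open WilsonRP WilsonSiteRP Literature.RepresentationTheory.CompactGroups

variable {d L N M : ℕ} [NeZero d] [NeZero L] {G : Type*} [Group G] [TopologicalSpace G]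
  [IsTopologicalGroup G] [CompactSpace G] [MeasurableSpace G] [BorelSpace G]
  (ρ : G →* Matrix (Fin N) (Fin N) ℂ) (π : G →* Matrix (Fin M) (Fin M) ℂ)

/-! ## §3 (A1.8) for `π`-Polyakov loops -/

section HalfCorrelator

/-- **Tomboulis–Yaffe (A1.8): the Polyakov-loop correlator at separation `L/2` is bounded by the
twist.** Torus `(ℤ/Lℤ)^d` with `L` even, compact `G`, continuous `N`-dimensional `ρ`, any real `β`,
a spatial direction `j` (`0 < j`), and a central `z ∈ G` with `ρ(z) = ω · 1`, `|ω| = 1`. Let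
`Πⱼ(x) = lineHolonomy U j L x` be the Polyakov loop in direction `j` through `x`,
`E = ⟨tr ρ(Πⱼ(0)) · conj tr ρ(Πⱼ((L/2) e₀))⟩_{Λ,β}`, and `r = Z(z; (0,j)) / Z(1; (0,j))` the ratio of
't Hooft's twisted to the untwisted partition function (`twistedPartitionFunction`). Then
`|1 - ω|² |E|² ≤ 8 N⁴ (1 - r)`. For `SU(2)` (`ω = -1`) and normalised traces this is the printed
`G_{L_s/2} ≤ 2 exp(-F^{elec}/2T)` with `exp(-F^{elec}/T) = ½(1 - r)` (eqs. (2.8)–(2.9), (A1.8)). Proof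
as printed: `(1 - ω) E = ⟨P P̄' (1 - 𝒪₀)⟩ - ω ⟨P P̄' (1 - 𝒪₋₁)⟩` (moving the stack across the loop at
time `0` multiplies it by `ω`), each term bounded by Cauchy–Schwarz for the reflection in the planes
`t = 0, L/2` containing both loops, and `⟨(1 - 𝒪)θ(1 - 𝒪)⟩ = 2(1 - r)` by the cancellation of
opposite adjacent stacks. [cite: TomboulisYaffe1985, App. I §C eq. (A1.8)] -/
theorem polyakovCorrelatorRep_half_normSq_le_twist (hL : Even L) (hρ : Continuous ρ) (hπ : Continuous π) (β : ℝ)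
    {j : Fin d} (hj : (0 : Fin d) < j) {z : G} (hz : z ∈ Subgroup.center G) {ω : ℂ}
    (hω : π z = ω • (1 : Matrix (Fin M) (Fin M) ℂ)) (hω1 : ‖ω‖ = 1) :
    ‖1 - ω‖ ^ 2 * ‖wilsonExpectation ρ β fun U : GaugeConfig d L G =>
        (π (lineHolonomy U j L 0)).trace *
          conj ((π (lineHolonomy U j L ((0 : Site d L) + Pi.single 0 ((L / 2 : ℕ) : ZMod L)))).trace)‖ ^ 2 ≤
      8 * (M : ℝ) ^ 4 * (1 - twistedPartitionFunction ρ β L z ⟨(0, j), hj⟩ /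
        twistedPartitionFunction ρ β L 1 ⟨(0, j), hj⟩) := by
  have h1L : 1 < L := by obtain ⟨r, hr⟩ := hL; have := NeZero.ne L; omega
  haveI : Fact (1 < L) := ⟨h1L⟩
  haveI := isProbabilityMeasure_wilsonMeasure (d := d) (L := L) ρ hρ β
  have hj0 : j ≠ 0 := fun h => (lt_irrefl (0 : Fin d)) (h ▸ hj)
  set Z1 : ℝ := twistedPartitionFunction ρ β L 1 ⟨((0 : Fin d), j), hj⟩ with hZ1
  set Zz : ℝ := twistedPartitionFunction ρ β L z ⟨((0 : Fin d), j), hj⟩ with hZz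
  set r : ℝ := Zz / Z1 with hr_def
  have hZ1pos : 0 < Z1 := twistedPartitionFunction_pos ρ hρ β 1 _
  have hr1 : r ≤ 1 :=
    (div_le_one hZ1pos).2 (twistedPartitionFunction_le_untwisted_plane ρ β hL hρ hz _)
  have hω0 : ω ≠ 0 := fun h => by rw [h, norm_zero] at hω1; exact zero_ne_one hω1
  have hωinv := map_inv_eq_smul π hω0 hω
  obtain ⟨rr, hrr⟩ := hL
  set m : ℕ := L / 2 with hm_def
  have hmL : m + m = L := by omega
  have hmlt : m < L := by have := NeZero.ne L; omega
  have hm0 : ((m : ℕ) : ZMod L) ≠ 0 := fun h => by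
    have := (ZMod.natCast_eq_zero_iff _ _).1 h
    exact absurd (Nat.le_of_dvd (by omega) this) (by omega)
  have hmm : ((m : ℕ) : ZMod L) + (m : ℕ) = 0 := by rw [← Nat.cast_add, hmL, ZMod.natCast_self]
  set xm : Site d L := (0 : Site d L) + Pi.single 0 ((m : ℕ) : ZMod L) with hxm
  have hxm0 : xm 0 = ((m : ℕ) : ZMod L) := by simp [hxm]
  have hxmj : xm j = 0 := by simp [hxm, Pi.single_eq_of_ne hj0]
  have hxmθ : xm.negReflect = xm := negReflect_of_two_mul (by rw [hxm0]; exact hmm)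
  have hx00 : (0 : Site d L).negReflect = 0 := negReflect_of_two_mul (by simp)
  -- the observables
  set P : GaugeConfig d L G → ℂ := fun U => (π (lineHolonomy U j L 0)).trace with hP
  set P' : GaugeConfig d L G → ℂ := fun U => (π (lineHolonomy U j L xm)).trace with hP'
  set f : GaugeConfig d L G → ℂ := fun U => P U * conj (P' U) with hf
  -- twist observables: `O w a` = exp(β(S - S_{w,(a,0)}))
  set O : G → ZMod L → GaugeConfig d L G → ℂ := fun w a U =>
    (Real.exp (β * (wilsonAction ρ U -
      insertedWilsonAction ρ (stackInsertion w ⟨((0 : Fin d), j), hj⟩ a 0) U)) : ℂ) with hO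
  -- reflection invariance of `P`, `P'`, `f`
  have hPθ : ∀ U : GaugeConfig d L G, P U.negReflect = P U := fun U => by
    simp only [hP, WilsonLoopRP.lineHolonomy_negReflect_of_ne U hj0, hx00]
  have hP'θ : ∀ U : GaugeConfig d L G, P' U.negReflect = P' U := fun U => by
    simp only [hP', WilsonLoopRP.lineHolonomy_negReflect_of_ne U hj0, hxmθ]
  have hfθ : ∀ U : GaugeConfig d L G, f U.negReflect = f U := fun U => by
    simp only [hf, hPθ, hP'θ]
  -- bounds and measurability of `f`
  have hPm : Measurable P := (WilsonLoopRP.entryMeasurable_lineHolonomy hπ j L 0).measurable_trace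
  have hP'm : Measurable P' := (WilsonLoopRP.entryMeasurable_lineHolonomy hπ j L xm).measurable_trace
  have hfm : Measurable f := hPm.mul (Complex.continuous_conj.measurable.comp hP'm)
  have hfb : ∀ U, ‖f U‖ ≤ (M : ℝ) * M := fun U => by
    rw [hf]; dsimp only; rw [norm_mul, Complex.norm_conj]
    exact mul_le_mul (norm_trace_le_dim π hπ _) (norm_trace_le_dim π hπ _) (norm_nonneg _) (Nat.cast_nonneg _)
  -- `f` is an admissible half-observable (both loops lie in the reflection planes)
  have hE : ∀ e : Edge d L, IsSitePosEdge e ∨ IsSharedEdge e →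
      e ∈ ((sitePosEdges ∪ sharedEdges : Finset (Edge d L)) : Set (Edge d L)) := fun e he => by
    rw [Finset.coe_union, Set.mem_union, Finset.mem_coe, Finset.mem_coe, mem_sitePosEdges,
      mem_sharedEdges]
    exact he
  have dep_line : ∀ (x : Site d L), (x 0 = 0 ∨ x 0 = ((m : ℕ) : ZMod L)) →
      DependsOn (fun U : GaugeConfig d L G => lineHolonomy U j L x)
      ((sitePosEdges ∪ sharedEdges : Finset (Edge d L)) : Set (Edge d L)) := by
    intro x hx U V hUV
    refine WilsonLoopRP.lineHolonomy_congr j L x fun s _ => hUV _ (hE _ (Or.inr ?_))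
    refine ⟨hj0, ?_⟩
    dsimp only
    rw [show (x + Pi.single j ((s : ℕ) : ZMod L) : Site d L) 0 = x 0 by simp [Pi.single_eq_of_ne hj0.symm]]
    rcases hx with hx | hx
    · left; rw [hx, ZMod.val_zero]
    · right; rw [hx, ZMod.val_natCast, Nat.mod_eq_of_lt hmlt]
  have hfdep : DependsOn f ((sitePosEdges ∪ sharedEdges : Finset (Edge d L)) : Set (Edge d L)) :=
    fun U V hUV => by
      simp only [hf, hP, hP', dep_line 0 (Or.inl rfl) hUV, dep_line xm (Or.inr hxm0) hUV]
  have hfobs : IsHalfObs f := ⟨hfm, ⟨_, hfb⟩, hfdep⟩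
  have hcfobs : IsHalfObs (fun U => conj (f U)) :=
    ⟨Complex.continuous_conj.measurable.comp hfm, ⟨_, fun U => by rw [Complex.norm_conj]; exact hfb U⟩,
      fun U V hUV => by simp only [hfdep hUV]⟩
  -- integrability helpers
  have hOobs : ∀ (w : G), IsHalfObs (fun U : GaugeConfig d L G => (1 : ℂ) - O w 0 U) := fun w =>
    isHalfObs_twistObs ρ ⟨rr, hrr⟩ hρ β w hj 0 1
  have hOm : ∀ (w : G) (a : ZMod L), Measurable (O w a) := fun w a =>
    Complex.measurable_ofReal.comp (Real.measurable_exp.comp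
      (((WilsonRP.measurable_wilsonAction ρ hρ).sub (measurable_insertedWilsonAction ρ hρ _)).const_mul β))
  have hOb : ∀ (w : G) (a : ZMod L), ∃ C : ℝ, ∀ U, ‖O w a U‖ ≤ C := fun w a =>
    ⟨_, fun U => by rw [hO]; exact norm_twistObs_le ρ hρ β _ U⟩
  have hint : ∀ (g : GaugeConfig d L G → ℂ), Measurable g → (∃ C : ℝ, ∀ U, ‖g U‖ ≤ C) →
      Integrable g (wilsonMeasure ρ β) := by
    rintro g hg ⟨C, hC⟩
    exact Integrable.of_bound hg.aestronglyMeasurable C (ae_of_all _ hC)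
  have hfO_m : ∀ (w : G) (a : ZMod L), Measurable (fun U => f U * O w a U) := fun w a =>
    hfm.mul (hOm w a)
  have hfO_b : ∀ (w : G) (a : ZMod L), ∃ C : ℝ, ∀ U, ‖f U * O w a U‖ ≤ C := fun w a => by
    obtain ⟨C, hC⟩ := hOb w a
    exact ⟨M * M * C, fun U => by
      rw [norm_mul]
      exact mul_le_mul (hfb U) (hC U) (norm_nonneg _)
        (mul_nonneg (Nat.cast_nonneg M) (Nat.cast_nonneg M))⟩
  -- expectations of twist observables
  have hOz : ∀ a : ZMod L, wilsonExpectation ρ β (O z a) = (r : ℂ) := fun a => by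
    rw [hO]; exact wilsonExpectation_twistObs ρ hρ β hz _ a 0
  have hOzi : ∀ a : ZMod L, wilsonExpectation ρ β (O z⁻¹ a) = (r : ℂ) := fun a => by
    rw [hO]
    have h := wilsonExpectation_twistObs ρ hρ β (Subgroup.inv_mem _ hz) ⟨((0 : Fin d), j), hj⟩ a 0
    rw [twistedPartitionFunction_inv ρ β hρ hz] at h
    exact h
  -- Step 1: moving the stack from `a = -1` to `a = 0` multiplies `P` by `ω⁻¹`
  set E : ℂ := wilsonExpectation ρ β f with hEdef
  have hmove : wilsonExpectation ρ β (fun U => f U * O z (-1) U) =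
      ω⁻¹ * wilsonExpectation ρ β (fun U => f U * O z 0 U) := by
    have h1 := wilsonExpectation_mul_twistObs ρ hρ β (stackInsertion z ⟨((0 : Fin d), j), hj⟩ (-1) 0) f
    have h2 := wilsonExpectation_mul_twistObs ρ hρ β (stackInsertion z ⟨((0 : Fin d), j), hj⟩ 0 0) f
    have h3 := integral_mul_exp_stack_succ ρ β hz ⟨((0 : Fin d), j), hj⟩ (-1) 0 f
    have hc : ∀ U : GaugeConfig d L G,
        f ((fun e : Edge d L => if e.2 = j ∧ e.1 0 = -1 + 1 ∧ e.1 j = 0 then z⁻¹ else 1) * U) =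
          ω⁻¹ * f U := by
      intro U
      have hc0 : lineHolonomy ((fun e : Edge d L => if e.2 = j ∧ e.1 0 = -1 + 1 ∧ e.1 j = 0 then z⁻¹
          else 1) * U) j L 0 = z⁻¹ * lineHolonomy U j L 0 :=
        lineHolonomy_stackMove_of_eq (-1) 0 U 0 (by simp) (by simp)
      have hcm : lineHolonomy ((fun e : Edge d L => if e.2 = j ∧ e.1 0 = -1 + 1 ∧ e.1 j = 0 then z⁻¹
          else 1) * U) j L xm = lineHolonomy U j L xm :=
        lineHolonomy_stackMove_of_ne hj0 z (-1) 0 U L xm (by rw [hxm0, neg_add_cancel]; exact hm0)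
      simp only [hf, hP, hP', hc0, hcm, trace_central_mul π hωinv]
      ring
    simp only [hO]
    rw [h1, h2, h3]
    dsimp only
    simp_rw [hc]
    simp only [neg_add_cancel, mul_assoc]
    rw [integral_const_mul, Complex.real_smul, Complex.real_smul]
    ring
  -- Step 2: the algebraic identity `(1 - ω) E = T₀ - ω T₋₁`
  have hsplit : ∀ a : ZMod L, E = wilsonExpectation ρ β (fun U => f U * ((1 : ℂ) - O z a U)) +
      wilsonExpectation ρ β (fun U => f U * O z a U) := fun a => by
    have i1 : Integrable (fun U => f U * ((1 : ℂ) - O z a U)) (wilsonMeasure ρ β) := by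
      obtain ⟨C, hC⟩ := hfO_b z a
      refine hint _ (hfm.mul (measurable_const.sub (hOm z a))) ⟨M * M + C, fun U => ?_⟩
      rw [mul_sub, mul_one]
      exact (norm_sub_le _ _).trans (add_le_add (hfb U) (hC U))
    rw [hEdef]
    unfold wilsonExpectation
    rw [← integral_add i1 (hint _ (hfO_m z a) (hfO_b z a))]
    refine integral_congr_ae (ae_of_all _ fun U => ?_)
    show f U = f U * (1 - O z a U) + f U * O z a U
    ring
  set T0 : ℂ := wilsonExpectation ρ β (fun U => f U * ((1 : ℂ) - O z 0 U)) with hT0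
  set T1 : ℂ := wilsonExpectation ρ β (fun U => f U * ((1 : ℂ) - O z (-1) U)) with hT1
  have hkey : (1 - ω) * E = T0 - ω * T1 := by
    have e0 := hsplit 0
    have e1 := hsplit (-1)
    rw [← hT0] at e0
    rw [← hT1, hmove] at e1
    have : ω * (E - T1) = wilsonExpectation ρ β (fun U => f U * O z 0 U) := by
      rw [e1, add_sub_cancel_left, ← mul_assoc, mul_inv_cancel₀ hω0, one_mul]
    linear_combination e0 - this
  -- Step 3: Cauchy–Schwarz for `T₀ = B(conj f, 1 - O_z,0)`
  have hB_f : ∀ (g : GaugeConfig d L G → ℂ), IsHalfObs g →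
      (siteRPForm ρ β (fun _ : Unit => fun U => conj (f U)) (fun _ : Unit => g)) =
        wilsonExpectation ρ β (fun U => f U * g U) := fun g hg => by
    unfold siteRPForm wilsonExpectation
    rw [Fintype.sum_unique]
    refine integral_congr_ae (ae_of_all _ fun U => ?_)
    simp only [Complex.conj_conj, hfθ]
  have hB_ff : (siteRPForm ρ β (fun _ : Unit => fun U => conj (f U)) (fun _ : Unit => fun U => conj (f U))).re
      ≤ (M : ℝ) ^ 4 := by
    unfold siteRPForm
    rw [Fintype.sum_unique]
    have hb : ∀ U : GaugeConfig d L G, ‖conj (conj (f U.negReflect)) * conj (f U)‖ ≤ (M : ℝ) ^ 4 := fun U => by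
      rw [norm_mul, Complex.norm_conj, Complex.norm_conj, Complex.norm_conj, hfθ,
        show (M : ℝ) ^ 4 = (M * M) * (M * M) by ring]
      exact mul_le_mul (hfb U) (hfb U) (norm_nonneg _) (by positivity)
    refine (Complex.re_le_norm _).trans ((norm_integral_le_of_norm_le_const (ae_of_all _ hb)).trans ?_)
    rw [probReal_univ, mul_one]
  -- the Gram entry of the twist observable: `⟨(1 - O')(1 - O)⟩ = 2(1 - r)`
  have hGram : ∀ (w : G), w ∈ Subgroup.center G →
      (wilsonExpectation ρ β (O w 0) = (r : ℂ)) → (wilsonExpectation ρ β (O w⁻¹ (-1)) = (r : ℂ)) →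
      siteRPForm ρ β (fun _ : Unit => fun U => (1 : ℂ) - O w 0 U) (fun _ : Unit => fun U => (1 : ℂ) - O w 0 U)
        = ((2 * (1 - r) : ℝ) : ℂ) := by
    intro w hw hw0 hw1
    have hrefl : ∀ U : GaugeConfig d L G, O w 0 U.negReflect = O w⁻¹ (-1) U := fun U => by
      simp only [hO, twistObs_negReflect ρ ⟨rr, hrr⟩ hρ β hw hj, zero_add]
    have hprod : wilsonExpectation ρ β (fun U => O w⁻¹ (-1) U * O w 0 U) = 1 := by
      have h := wilsonExpectation_twistObs_inv_mul_twistObs ρ hρ β hw ⟨((0 : Fin d), j), hj⟩ (-1 : ZMod L) 0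
      simp only [neg_add_cancel] at h
      rw [hO]; exact h
    unfold siteRPForm
    rw [Fintype.sum_unique]
    have hreal : ∀ U : GaugeConfig d L G, conj ((1 : ℂ) - O w 0 U.negReflect) = 1 - O w⁻¹ (-1) U := fun U => by
      rw [map_sub, map_one, hrefl, hO]; dsimp only; rw [Complex.conj_ofReal]
    simp_rw [hreal]
    have hpt : ∀ U : GaugeConfig d L G, ((1 : ℂ) - O w⁻¹ (-1) U) * (1 - O w 0 U) =
        1 - O w⁻¹ (-1) U - O w 0 U + O w⁻¹ (-1) U * O w 0 U := fun U => by ring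
    simp_rw [hpt]
    have i1 : Integrable (fun _ : GaugeConfig d L G => (1 : ℂ)) (wilsonMeasure ρ β) := integrable_const _
    have i2 := hint _ (hOm w⁻¹ (-1)) (hOb w⁻¹ (-1))
    have i3 := hint _ (hOm w 0) (hOb w 0)
    have i12 : Integrable (fun U : GaugeConfig d L G => (1 : ℂ) - O w⁻¹ (-1) U) (wilsonMeasure ρ β) :=
      i1.sub i2
    have i123 : Integrable (fun U : GaugeConfig d L G => (1 : ℂ) - O w⁻¹ (-1) U - O w 0 U)
        (wilsonMeasure ρ β) := i12.sub i3
    have i4 : Integrable (fun U => O w⁻¹ (-1) U * O w 0 U) (wilsonMeasure ρ β) := by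
      obtain ⟨C2, hC2⟩ := hOb w⁻¹ (-1)
      obtain ⟨C3, hC3⟩ := hOb w 0
      exact hint _ ((hOm _ _).mul (hOm _ _)) ⟨C2 * C3, fun U => by
        rw [norm_mul]; exact mul_le_mul (hC2 U) (hC3 U) (norm_nonneg _) ((norm_nonneg _).trans (hC2 U))⟩
    rw [integral_add i123 i4, integral_sub i12 i3, integral_sub i1 i2,
      integral_const, probReal_univ, one_smul]
    change 1 - wilsonExpectation ρ β (O w⁻¹ (-1)) - wilsonExpectation ρ β (O w 0) +
      wilsonExpectation ρ β (fun U => O w⁻¹ (-1) U * O w 0 U) = _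
    rw [hw1, hw0, hprod]
    push_cast
    ring
  have hGz := hGram z hz (hOz 0) (hOzi (-1))
  have hGzi := hGram z⁻¹ (Subgroup.inv_mem _ hz) (hOzi 0) (by rw [inv_inv]; exact hOz (-1))
  -- `|T₀|² ≤ N⁴ · 2(1-r)`
  have hT0b : ‖T0‖ ^ 2 ≤ (M : ℝ) ^ 4 * (2 * (1 - r)) := by
    have hCS := normSq_siteRPForm_le ρ ⟨rr, hrr⟩ hρ β (fun _ : Unit => hcfobs) (fun _ : Unit => hOobs z)
    rw [hB_f _ (hOobs z), hGz, Complex.ofReal_re] at hCS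
    rw [hT0]
    exact hCS.trans (mul_le_mul_of_nonneg_right hB_ff (by linarith))
  -- `|T₋₁|² ≤ 2(1-r) · N⁴`: here the twist observable is reflected to the positive side
  have hT1b : ‖T1‖ ^ 2 ≤ (2 * (1 - r)) * (M : ℝ) ^ 4 := by
    have hF' : IsHalfObs (fun U : GaugeConfig d L G => (1 : ℂ) - O z⁻¹ 0 U) := hOobs z⁻¹
    have hCS := normSq_siteRPForm_le ρ ⟨rr, hrr⟩ hρ β (fun _ : Unit => hF') (fun _ : Unit => hfobs)
    have h12 : siteRPForm ρ β (fun _ : Unit => fun U => (1 : ℂ) - O z⁻¹ 0 U) (fun _ : Unit => f) = T1 := by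
      unfold siteRPForm
      rw [Fintype.sum_unique, hT1]
      unfold wilsonExpectation
      refine integral_congr_ae (ae_of_all _ fun U => ?_)
      have hrefl : O z⁻¹ 0 U.negReflect = O z (-1) U := by
        simp only [hO, twistObs_negReflect ρ ⟨rr, hrr⟩ hρ β (Subgroup.inv_mem _ hz) hj, zero_add, inv_inv]
      show conj ((1 : ℂ) - O z⁻¹ 0 U.negReflect) * f U = f U * (1 - O z (-1) U)
      rw [map_sub, map_one, hrefl, hO]; dsimp only; rw [Complex.conj_ofReal]; ring
    have h22 : (siteRPForm ρ β (fun _ : Unit => f) (fun _ : Unit => f)).re ≤ (M : ℝ) ^ 4 := by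
      unfold siteRPForm
      rw [Fintype.sum_unique]
      have hb : ∀ U : GaugeConfig d L G, ‖conj (f U.negReflect) * f U‖ ≤ (M : ℝ) ^ 4 := fun U => by
        rw [norm_mul, Complex.norm_conj, hfθ, show (M : ℝ) ^ 4 = (M * M) * (M * M) by ring]
        exact mul_le_mul (hfb U) (hfb U) (norm_nonneg _) (by positivity)
      refine (Complex.re_le_norm _).trans ((norm_integral_le_of_norm_le_const (ae_of_all _ hb)).trans ?_)
      rw [probReal_univ, mul_one]
    rw [h12, hGzi, Complex.ofReal_re] at hCS
    exact hCS.trans (mul_le_mul_of_nonneg_left h22 (by linarith))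
  -- Step 4: assemble
  have hA0 : 0 ≤ (M : ℝ) ^ 4 * (2 * (1 - r)) := mul_nonneg (by positivity) (by linarith)
  have hT0n : ‖T0‖ ≤ Real.sqrt ((M : ℝ) ^ 4 * (2 * (1 - r))) := by
    simpa only [abs_norm] using Real.abs_le_sqrt hT0b
  have hT1n : ‖T1‖ ≤ Real.sqrt ((M : ℝ) ^ 4 * (2 * (1 - r))) := by
    rw [mul_comm] at hT1b
    simpa only [abs_norm] using Real.abs_le_sqrt hT1b
  have hEq : ‖1 - ω‖ * ‖E‖ ≤ 2 * Real.sqrt ((M : ℝ) ^ 4 * (2 * (1 - r))) := by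
    calc ‖1 - ω‖ * ‖E‖ = ‖T0 - ω * T1‖ := by rw [← norm_mul, hkey]
      _ ≤ ‖T0‖ + ‖ω * T1‖ := norm_sub_le _ _
      _ = ‖T0‖ + ‖T1‖ := by rw [norm_mul, hω1, one_mul]
      _ ≤ _ := by linarith
  have hsq := pow_le_pow_left₀ (mul_nonneg (norm_nonneg _) (norm_nonneg _)) hEq 2
  rw [mul_pow, mul_pow, Real.sq_sqrt hA0] at hsq
  change ‖1 - ω‖ ^ 2 * ‖E‖ ^ 2 ≤ 8 * (M : ℝ) ^ 4 * (1 - r)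
  calc ‖1 - ω‖ ^ 2 * ‖E‖ ^ 2 ≤ 2 ^ 2 * ((M : ℝ) ^ 4 * (2 * (1 - r))) := hsq
    _ = 8 * (M : ℝ) ^ 4 * (1 - r) := by ring

end HalfCorrelator

end Summit.QuantumFields.YangMills.Cruxes.IR.TensionRatio.FluxTY

end
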